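import Literature.Topology.FourManifolds.LickorishWallace
import Literature.Topology.FourManifolds.LickorishTwistSurgery
import Literature.Topology.FourManifolds.TrisectionSectorCollars
import Literature.Topology.FourManifolds.TrisectionFunctorGKInputs
import Literature.Topology.FourManifolds.OneHandlebodyBoundaryFundamentalGroup
import Literature.AlgebraicTopology.FundamentalGroup.VanKampenClosedCover
import Literature.AlgebraicTopology.FundamentalGroup.InclHomTransport
import HarnessLib

/-!
# Stub `stub_vanKampenGluedHandlebodies` of line `jaco-splitting-homomorphism` for crux `CongruenceShadows.WaldhausenPairs`
(item stmt-SmoothPoincare4-14592, route route-SmoothPoincare4-CongruenceShadows)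

**Seifert–van Kampen for a glued pair of handlebodies** (Hempel, *3-Manifolds* (1976), Lemma 14.4;
Hatcher, *Algebraic Topology* (2002), Thm. 1.20).  Let `Y = H₁ ∪_f H₂` be an explicit boundary
gluing (`IsBoundaryGluingWith b₁ b₂ f (𝓡 3) j₁ j₂`) of two genus-`g` handlebodies
(`IsHandlebody g Hᵣ`) along a diffeomorphism `f : ∂H₁ ≅ ∂H₂`, and let `y` be a point of the seam
`Σ = j₁(H₁) ∩ j₂(H₂)`.  Then the map `π₁(Σ, y) → π₁(j₁(H₁) ∪ j₂(H₂), y)` induced by the inclusion is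
surjective, with kernel the normal closure of `ker (π₁ Σ → π₁ j₁(H₁)) ∪ ker (π₁ Σ → π₁ j₂(H₂))` — in
exactly the output shape of the tree's `VanKampen.surjective_and_ker_eq_of_closed_cover_collars`
(closed cover `R₁ = j₁(H₁)`, `R₂ = j₂(H₂)`, `F = R₁ ∩ R₂ = Σ`), which we feed as the PROVED template
`IsGKTrisection.surjective_and_ker_eq_handlebody_union` does:

* `Rᵣ` is closed (compact `Hᵣ`, Hausdorff `Y`) and path connected (connected manifold `Hᵣ`);
* `Σ = jᵣ(∂Hᵣ)` for both `r` (seam relation `IsBoundaryGluingWith.apply_eq_apply_iff`, `f` onto), so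
  `Σ` is path connected (`HasHandleDecomposition.isPathConnected_boundary`: the boundary of a
  `1`-handlebody is connected) and has a collar `Cᵣ = Rᵣ ∩ Oᵣ ⊇ Σ` in `Rᵣ` strong deformation
  retracting onto it (`exists_collar_over`, the image of an open collar of `∂Hᵣ`);
* `π₁(Σ, y) → π₁(Rᵣ, y)` is onto: `π₁(∂H) → π₁(H)` is onto for a `3`-dimensional `1`-handlebody
  (`HasHandleDecomposition.surjective_inclHom_boundary`, Morse theory), transported along the
  embedding `jᵣ` (`InclHomTransport.lean`).

This is the registered stub `stub_vanKampenGluedHandlebodies` (S2b) of the checked skeleton of the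
line; its consumer is the glue `vanKampenPairQuotient_of` there.  Everything is proved from tree
declarations; no definitions, no named facts.
-/

-- the prescribed namespace `Summit.<P>.<Sub>.…` duplicates `SmoothPoincare4` (P = Sub)
set_option linter.dupNamespace false
noncomputable section
open scoped Manifold ContDiff Topology
open Set Function Subgroup Literature.Topology.FourManifolds
open Literature.AlgebraicTopology Literature.AlgebraicTopology.FundamentalGroup
  Literature.AlgebraicTopology.FundamentalGroup.VanKampen

namespace Summit.SmoothPoincare4.SmoothPoincare4.Theorems.WaldhausenPairs.JacoSplittingHomomorphism

universe u

section Helpers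

variable {H₁ : Type u} [TopologicalSpace H₁] [ChartedSpace (EuclideanHalfSpace 3) H₁]
  {H₂ : Type u} [TopologicalSpace H₂] [ChartedSpace (EuclideanHalfSpace 3) H₂]
  {b₁ : BoundaryData (𝓡∂ 3) H₁ (𝓡 2)} {b₂ : BoundaryData (𝓡∂ 3) H₂ (𝓡 2)}
  {f : b₁.carrier ≃ₘ⟮𝓡 2, 𝓡 2⟯ b₂.carrier}
  {Y : Type*} [TopologicalSpace Y] [ChartedSpace (EuclideanSpace ℝ (Fin 3)) Y]
  {j₁ : H₁ → Y} {j₂ : H₂ → Y}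

/-- **The seam is the image of the left boundary**: for an explicit gluing `Y = H₁ ∪_f H₂`,
`j₁(∂H₁) = j₁(H₁) ∩ j₂(H₂)` (seam relation `jM x = jN y ↔ x = incl z ∧ y = incl (f z)` and
`∂H₁ = range incl₁`). [folklore] -/
private theorem image_boundary_left_eq_inter (hj : IsBoundaryGluingWith b₁ b₂ f (𝓡 3) j₁ j₂) :
    j₁ '' (𝓡∂ 3).boundary H₁ = range j₁ ∩ range j₂ := by
  rw [← b₁.range_incl, ← range_comp]
  ext y
  constructor
  · rintro ⟨z, rfl⟩
    exact ⟨mem_range_self _, b₂.incl (f z), (hj.apply_incl z).symm⟩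
  · rintro ⟨⟨a, rfl⟩, c, hc⟩
    obtain ⟨z, rfl, -⟩ := (hj.apply_eq_apply_iff a c).1 hc.symm
    exact ⟨z, rfl⟩

/-- **The seam is the image of the right boundary**: for an explicit gluing `Y = H₁ ∪_f H₂` along
a diffeomorphism `f` (a bijection suffices), `j₂(∂H₂) = j₁(H₁) ∩ j₂(H₂)`. [folklore] -/
private theorem image_boundary_right_eq_inter (hj : IsBoundaryGluingWith b₁ b₂ f (𝓡 3) j₁ j₂) :
    j₂ '' (𝓡∂ 3).boundary H₂ = range j₁ ∩ range j₂ := by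
  rw [← b₂.range_incl, ← range_comp]
  ext y
  constructor
  · rintro ⟨w, rfl⟩
    obtain ⟨z, rfl⟩ := f.surjective w
    exact ⟨⟨b₁.incl z, hj.apply_incl z⟩, mem_range_self _⟩
  · rintro ⟨⟨a, ha⟩, c, rfl⟩
    obtain ⟨z, -, rfl⟩ := (hj.apply_eq_apply_iff a c).1 ha
    exact ⟨f z, rfl⟩

end Helpers

section Handlebody

variable {g : ℕ} {H : Type*} [TopologicalSpace H] [ChartedSpace (EuclideanHalfSpace 3) H]
  [IsManifold (𝓡∂ 3) ∞ H] {Y : Type*} [TopologicalSpace Y]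

/-- **`π₁(j(∂H), y) → π₁(j(H), y)` is onto for an embedded handlebody.**  For a genus-`g`
handlebody `H` topologically embedded by `j` in a Hausdorff second countable space and a subset
`S = j(∂H)` with base point `y ∈ S`, the map induced by `S ⊆ range j` on fundamental groups is
surjective: `π₁(∂H) → π₁(H)` is onto (`HasHandleDecomposition.surjective_inclHom_boundary`, one
`0`-handle and `g` `1`-handles), transported along `j`. [cite: HatcherAT2002, Prop. 1.26 and Prop. 1.18] -/
private theorem surjective_inclHomOfSubset_of_isHandlebody [T2Space Y] [SecondCountableTopology Y]
    (hH : IsHandlebody g H) {j : H → Y} (hj : Topology.IsEmbedding j) {S : Set Y}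
    (hS : j '' (𝓡∂ 3).boundary H = S) (hST : S ⊆ range j) {y : Y} (hy : y ∈ S) :
    Function.Surjective (inclHomOfSubset hST y hy (hST hy)) := by
  haveI := hH.compactSpace
  haveI := hH.connectedSpace
  haveI : T2Space H := hj.t2Space
  haveI : SecondCountableTopology H := hj.secondCountableTopology
  have hy' : y ∈ j '' (𝓡∂ 3).boundary H := by rw [hS]; exact hy
  obtain ⟨z, hz, hzy⟩ := hy'
  have hs := hH.hasHandleDecomposition.surjective_inclHom_boundary (handleCount_zero 1 g)
    (fun k hk => handleCount_of_two_le 1 g hk) le_rfl hz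
  have hs' := (surjective_inclHom_iff_image_of_isEmbedding hj hz).1 hs
  rw [surjective_inclHomOfSubset_congr' hS rfl (image_subset_range j _) hST
    (mem_image_of_mem j hz) (hS ▸ mem_image_of_mem j hz)] at hs'
  exact (surjective_inclHomOfSubset_congr_pt _ hzy _ hy).1 hs'

/-- **The image of the boundary of an embedded handlebody is path connected**: `∂H` is path
connected (`HasHandleDecomposition.isPathConnected_boundary`: `1`-handles do not disconnect the
boundary sphere of the `0`-handle). [cite: Kosinski1993, VI (11.5)] -/
private theorem isPathConnected_image_boundary_of_isHandlebody [T2Space Y] (hH : IsHandlebody g H)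
    {j : H → Y} (hj : Topology.IsEmbedding j) : IsPathConnected (j '' (𝓡∂ 3).boundary H) := by
  haveI := hH.compactSpace
  haveI := hH.connectedSpace
  haveI : T2Space H := hj.t2Space
  exact (hH.hasHandleDecomposition.isPathConnected_boundary
    (fun k hk => handleCount_of_two_le 1 g hk) one_le_two).image hj.continuous

/-- **The image of an embedded handlebody is path connected** (a connected manifold is path
connected). [folklore] -/
private theorem isPathConnected_range_of_isHandlebody (hH : IsHandlebody g H) {j : H → Y}
    (hj : Topology.IsEmbedding j) : IsPathConnected (range j) := by
  haveI := hH.connectedSpace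
  haveI : LocallyPathConnectedSpace H :=
    ChartedSpace.locallyPathConnectedSpace (EuclideanHalfSpace 3) H
  haveI : PathConnectedSpace H := pathConnectedSpace_iff_connectedSpace.2 hH.connectedSpace
  exact isPathConnected_range hj.continuous

/-- **A collar of `j(∂H)` inside `j(H)`**: for a compact handlebody `H` embedded by `j` in a
Hausdorff space and `S = j(∂H)`, there is `C = range j ∩ O` (`O` open) containing `S` and strong
deformation retracting onto it — the image of an open collar of `∂H` (`exists_collar_over`;
Hirsch (1976), Thm. 4.6.1). [cite: Hirsch1976, Thm. 4.6.1] -/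
private theorem exists_collar_of_isHandlebody [T2Space Y] (hH : IsHandlebody g H) {j : H → Y}
    (hj : Topology.IsEmbedding j) {S : Set Y} (hS : j '' (𝓡∂ 3).boundary H = S) :
    ∃ C O : Set Y, IsOpen O ∧ C = range j ∩ O ∧ S ⊆ C ∧
      Homotopy.IsStrongDeformationRetractOf S C := by
  haveI := hH.compactSpace
  haveI : T2Space H := hj.t2Space
  obtain ⟨C, O, hO, hC, -, hSC, hsdr⟩ := exists_collar_over (n := 1) hj isOpen_univ
    (N := j '' (𝓡∂ 3).boundary H) (by rw [inter_univ])
  subst hS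
  exact ⟨C, O, hO, hC, hSC, hsdr⟩

end Handlebody

/-- **Seifert–van Kampen for two glued handlebodies** (stub S2b of line
`jaco-splitting-homomorphism`; Hempel, *3-Manifolds* (1976), Lemma 14.4 in the subspace form of
`VanKampen.surjective_and_ker_eq_of_closed_cover_collars`).  For an explicit boundary gluing
`Y = H₁ ∪_f H₂` of two genus-`g` handlebodies and a base point `y` of the seam
`Σ = j₁(H₁) ∩ j₂(H₂)`, the map `π₁(Σ, y) → π₁(j₁(H₁) ∪ j₂(H₂), y)` induced by the inclusion is
surjective and its kernel is the normal closure of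
`ker (π₁ Σ → π₁ j₁(H₁)) ∪ ker (π₁ Σ → π₁ j₂(H₂))`.  The closed pieces `j₁(H₁)`, `j₂(H₂)` (compact,
hence closed; path connected) meet exactly in `Σ = j₁(∂H₁) = j₂(∂H₂)` (seam relation), which is
path connected and collared on both sides (images of open collars of `∂Hᵣ`), and
`π₁(Σ) → π₁(jᵣ(Hᵣ))` is onto (`π₁(∂H) ↠ π₁(H)` for a `1`-handlebody, transported along `jᵣ`).
Uses the handlebody structure only for: compactness, connectedness, `π₁(∂H) ↠ π₁(H)`, `∂H` path
connected, and the collar of `∂H`. [cite: Hempel1976, Lemma 14.4] [cite: HatcherAT2002, Thm. 1.20] -/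
theorem stub_vanKampenGluedHandlebodies :
    ∀ (g : ℕ)
      (H₁ : Type) [TopologicalSpace H₁] [ChartedSpace (EuclideanHalfSpace 3) H₁] [IsManifold (𝓡∂ 3) ∞ H₁]
      (H₂ : Type) [TopologicalSpace H₂] [ChartedSpace (EuclideanHalfSpace 3) H₂] [IsManifold (𝓡∂ 3) ∞ H₂]
      (b₁ : BoundaryData (𝓡∂ 3) H₁ (𝓡 2)) (b₂ : BoundaryData (𝓡∂ 3) H₂ (𝓡 2))
      (f : b₁.carrier ≃ₘ⟮𝓡 2, 𝓡 2⟯ b₂.carrier)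
      (Y : Type) [TopologicalSpace Y] [T2Space Y] [SecondCountableTopology Y]
      [ChartedSpace (EuclideanSpace ℝ (Fin 3)) Y] [IsManifold (𝓡 3) ∞ Y]
      (j₁ : H₁ → Y) (j₂ : H₂ → Y) (_ : IsHandlebody g H₁) (_ : IsHandlebody g H₂)
      (_ : IsBoundaryGluingWith b₁ b₂ f (𝓡 3) j₁ j₂) (y : Y) (hy : y ∈ range j₁ ∩ range j₂),
      Function.Surjective (inclHomOfSubset
          (inter_subset_left.trans subset_union_left : range j₁ ∩ range j₂ ⊆ range j₁ ∪ range j₂)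
          y hy (Or.inl hy.1)) ∧
        (inclHomOfSubset
            (inter_subset_left.trans subset_union_left : range j₁ ∩ range j₂ ⊆ range j₁ ∪ range j₂)
            y hy (Or.inl hy.1)).ker =
          Subgroup.normalClosure
            (((inclHomOfSubset (inter_subset_left : range j₁ ∩ range j₂ ⊆ range j₁) y hy hy.1).ker :
                Set _) ∪
              (inclHomOfSubset (inter_subset_right : range j₁ ∩ range j₂ ⊆ range j₂) y hy hy.2).ker) := by
  intro g H₁ _ _ _ H₂ _ _ _ b₁ b₂ f Y _ _ _ _ _ j₁ j₂ hH₁ hH₂ hj y hy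
  haveI := hH₁.compactSpace
  haveI := hH₂.compactSpace
  have he₁ : Topology.IsEmbedding j₁ := hj.isSmoothEmbedding_left.isEmbedding
  have he₂ : Topology.IsEmbedding j₂ := hj.isSmoothEmbedding_right.isEmbedding
  have hS₁ := image_boundary_left_eq_inter hj
  have hS₂ := image_boundary_right_eq_inter hj
  -- collars of the seam inside the two pieces
  obtain ⟨C₁, O₁, hO₁, hC₁, hFC₁, hsdr₁⟩ := exists_collar_of_isHandlebody hH₁ he₁ hS₁
  obtain ⟨C₂, O₂, hO₂, hC₂, hFC₂, hsdr₂⟩ := exists_collar_of_isHandlebody hH₂ he₂ hS₂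
  exact surjective_and_ker_eq_of_closed_cover_collars
    (isCompact_range he₁.continuous).isClosed (isCompact_range he₂.continuous).isClosed
    inter_subset_left inter_subset_right Subset.rfl hO₁ hC₁ hFC₁ hO₂ hC₂ hFC₂ hsdr₁ hsdr₂
    (isPathConnected_range_of_isHandlebody hH₁ he₁) (isPathConnected_range_of_isHandlebody hH₂ he₂)
    (hS₁ ▸ isPathConnected_image_boundary_of_isHandlebody hH₁ he₁) hy
    (surjective_inclHomOfSubset_of_isHandlebody hH₁ he₁ hS₁ inter_subset_left hy)
    (surjective_inclHomOfSubset_of_isHandlebody hH₂ he₂ hS₂ inter_subset_right hy)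

end Summit.SmoothPoincare4.SmoothPoincare4.Theorems.WaldhausenPairs.JacoSplittingHomomorphism
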